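import Summits.NavierStokesRegularity.NavierStokesRegularity.Theses.TerminalTrace
import Summits.NavierStokesRegularity.NavierStokesRegularity.Theorems.TerminalTraceTypeITraceScarL3ExtinctApexTopVanishing
import Literature.Analysis.FluidPDE.SereginSverak2002PressureLowerBound
import HarnessLib

/-!
# Route `TerminalTrace`: the support item `TraceScarL3` (stmt-NavierStokesRegularity-18384) FOLLOWS BY NAME
# from the crux `TraceDensityCriterion` (stmt-NavierStokesRegularity-18614) — Hölder + the `L^∞` bridge

Seat nsreg-C26-p1 g6 (cell ns-regularity-ideate), `--supports stmt-NavierStokesRegularity-18384` (helper: the route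
file's own proof sketch of the item, «follows from TraceDensityCriterion by Hölder and the L∞ bridge of `closes`»,
as a kernel record; nothing here closes an item — the crux `TraceDensityCriterion` is OPEN).

* `TerminalTrace.traceScarL3_of_traceDensityCriterion : TraceDensityCriterion → TraceScarL3`.
  Proof: if `u T ∈ L³(B(x₀, ρ))` then the scaled energy of the final value vanishes at `x₀`,
  `r⁻¹ ∫_{B(x₀,r)} ‖u T‖² → 0` (`TypeITraceScarL3.tendsto_scaledEnergy_zero_of_memLp_three`: Hölder on balls and
  absolute continuity of `‖u T‖³`), so the crux makes `(T, x₀)` backward bounded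
  (`Literature.Analysis.FluidPDE.IsBackwardBoundedAt`, the crux's inline conclusion verbatim), and a backward bounded
  point has a backward parabolic cylinder on which `u` is essentially bounded
  (`IsBackwardBoundedAt.eLpNorm_parabolicCylinder_lt_top`) — contradicting the singular-vertex premise
  `∀ r > 0, ‖u‖_{L^∞(Q_r(T, x₀))} = ⊤`.

WHAT THIS IS NOT: not NS regularity, not the crux 18614, not the item 18384 unconditionally — a by-name reduction
`18384 ⇐ 18614`. [folklore] [cite: SereginSverak2002, Thm. 2.2 (p. 70)]
-/

set_option linter.dupNamespace false

noncomputable section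

open MeasureTheory Set Function Filter Topology Metric
open Literature.Analysis.FluidPDE

namespace Summit.NavierStokesRegularity.NavierStokesRegularity.Theorems

/-- **`TraceScarL3 ⇐ TraceDensityCriterion`** (route `TerminalTrace`, items stmt-NavierStokesRegularity-18384 ⇐
stmt-NavierStokesRegularity-18614): an `L³` ball of the final value at a vertex has vanishing scaled energy there
(Hölder), so the final-value density criterion makes the vertex backward bounded, which a backward-singular vertex is
not. [folklore] [cite: SereginSverak2002, Thm. 2.2 (p. 70)] -/
theorem TerminalTrace.traceScarL3_of_traceDensityCriterion
    (h : Summit.NavierStokesRegularity.NavierStokesRegularity.Theses.TerminalTrace.TraceDensityCriterion) :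
    Summit.NavierStokesRegularity.NavierStokesRegularity.Theses.TerminalTrace.TraceScarL3 := by
  intro ν T hν hT u p hcl hLH hdec x₀ hsing ρ hρ hmem
  -- Hölder: the `L³` ball gives vanishing scaled energy of the final value at `x₀`
  have hFE : Tendsto (fun r : ℝ => r⁻¹ * ∫ x in ball x₀ r, ‖u T x‖ ^ 2) (𝓝[>] 0) (𝓝 0) :=
    TypeITraceScarL3.tendsto_scaledEnergy_zero_of_memLp_three hρ hmem
  -- the crux: `(T, x₀)` is backward bounded
  have hbb : IsBackwardBoundedAt u T x₀ := h ν T hν hT u p hcl hLH hdec x₀ hFE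
  -- the `L^∞` bridge: a bounded backward cylinder is not a singular one
  obtain ⟨r, hr, hfin⟩ := hbb.eLpNorm_parabolicCylinder_lt_top
  exact hfin.ne (hsing r hr)

end Summit.NavierStokesRegularity.NavierStokesRegularity.Theorems

end
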